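import Summits.BirchSwinnertonDyer.BirchSwinnertonDyer.Theses.QuadraticBranchSignedControl
import Summits.BirchSwinnertonDyer.Rank1Residual.Additive.StrictSignedSelmer
import Literature.NumberTheory.GaloisRepresentations.PadicAlgebraDegreeOnePlace
import HarnessLib

/-!
# Route `QuadraticBranchSignedControl` (rung K8, cell `bsd-potss`), crux `EtaTransportSigned`
# (item stmt-BirchSwinnertonDyer-19115), stub `stub_etaMC_plus`, frame (i-f) — first half:
# over `ℚ`, Kobayashi's Def. 1.1 plus Selmer group IS p17's plus Selmer group AT THE ADIC MODEL
# `Kobayashi2003.signedSelmerInfty V κ 1 = strictSignedSelmerInfty V κ ℚ_{v₀} 1` (`v₀ ∣ p`)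

WHAT. The model-transfer frame (i-f) of `…EtaTransportDecompositionOfFrames.lean` asks for
`Kobayashi2003.signedSelmerInfty V κ 1 = strictSignedSelmerInfty V κ ℚ_[p] 1` (two additive subgroups
of `H¹(Gal(ℚ̄/ℚ_∞), V[p^∞])`). The left side (Kobayashi 2003 Def. 1.1 as transcribed in
`Kobayashi2003/SignedSelmer.lean`) imposes the plus Kummer condition at EVERY place `v` of `ℚ` with
`p ∈ v` through the adic model `v.adicCompletion ℚ`; the right side (p17's `StrictSignedSelmer.lean`)
at ONE caller-supplied model `E`, with the strict group, which for the sign `+` IS the plus group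
(`strictSignedLocalPointsOfEmb_one`). Over `ℚ` there is exactly one place above `p`
(`heightOneSpectrum_rat_eq_of_natCast_mem`), so AT THE ADIC MODEL `E = v₀.adicCompletion ℚ` the two
subgroups COINCIDE, layer by layer and in the limit — this file. What then remains of (i-f) is the
pure change of model `ℚ_{v₀} ≃ ℚ_[p]` (Mathlib `Rat.HeightOneSpectrum.adicCompletion.padicEquiv`) for
`strictSignedSelmerInfty V κ · 1`, i.e. a transport of `localKummerOverOfEmb`/`signedLocalPoints`
along a `ℚ`-algebra isomorphism of models (x1b's `LocalModelTransport*` pattern), NOT done here.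

HONEST FRAMING (cell `bsd-potss`, run/shared/lean/pub/bsd-potss/; FULL-BSD rank ≤ 1 programme):
TOOL THEOREMS ONLY — no definition, no named Literature fact, no `sorry`, axioms standard;
UNCONDITIONAL bookkeeping. Nothing about (C1_η), Kobayashi's theorems or `BSD(W, p)` is claimed;
no label or count moves. Seat `bsd-potss-k8q-c3` (prover), g0.

References: [Kobayashi2003] Def. 1.1 (p. 2) ("`F_{n,p}` is the completion of `F_n` at the place over
`p`"), Def. 2.1 (p. 5); [SerreGaloisCohomology1997] II.§1.1.
-/

set_option autoImplicit false
set_option linter.dupNamespace false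

noncomputable section

open scoped Classical

open Field WeierstrassCurve NumberField IsDedekindDomain
open Literature.NumberTheory.EllipticCurves
open Literature.NumberTheory.GaloisRepresentations
open Summit.BirchSwinnertonDyer.Rank1Residual.Additive

namespace Summit.BirchSwinnertonDyer.BirchSwinnertonDyer.Theorems

variable (V : WeierstrassCurve ℚ) {p : ℕ} [Fact p.Prime] (κ : ZpExtension ℚ p)
  (v₀ : HeightOneSpectrum (𝓞 ℚ)) (hv₀ : ((p : ℕ) : 𝓞 ℚ) ∈ v₀.asIdeal)

include hv₀ in
/-- **Layer by layer: Kobayashi's `Sel⁺(V/ℚ_n)` (Def. 1.1, condition at every place above `p`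
through the adic models) = p17's `Sel^{+,str}(V/ℚ_n)` at the adic model `ℚ_{v₀}`** — `ℚ` has ONE
place `v₀` above `p`, and the strict plus group is the plus group. [cite: Kobayashi2003, Def. 1.1 (p. 2)] -/
theorem signedSelmerLayer_one_eq_strictSignedSelmerLayer_adicCompletion (n : ℕ) :
    Kobayashi2003.signedSelmerLayer V κ 1 n =
      strictSignedSelmerLayer V κ (v₀.adicCompletion ℚ) 1 n := by
  ext c
  rw [Kobayashi2003.mem_signedSelmerLayer_iff, mem_strictSignedSelmerLayer_iff]
  refine and_congr_right fun _ => ⟨fun h σ => ?_, fun h v hv σ => ?_⟩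
  · have h' := h v₀ hv₀ σ
    rwa [strictSignedLocalPoints, strictSignedLocalPointsOfEmb_one]
  · have hvv : v = v₀ := LocalField.heightOneSpectrum_rat_eq_of_natCast_mem p v v₀ hv hv₀
    subst hvv
    have h' := h σ
    rwa [strictSignedLocalPoints, strictSignedLocalPointsOfEmb_one] at h'

include hv₀ in
/-- **(i-f), first half: `Sel⁺(V/ℚ_∞)` of Kobayashi's Def. 1.1 = p17's `Sel^{+,str}(V/ℚ_∞)` at the
adic model `ℚ_{v₀}`** (`v₀` the place of `ℚ` above `p`): the two limits are the unions of the images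
of equal layers. What remains of frame (i-f) is the change of model `ℚ_{v₀} ≃ ℚ_[p]` on the right.
[cite: Kobayashi2003, Def. 1.1 (p. 2)] -/
theorem signedSelmerInfty_one_eq_strictSignedSelmerInfty_adicCompletion :
    Kobayashi2003.signedSelmerInfty V κ 1 = strictSignedSelmerInfty V κ (v₀.adicCompletion ℚ) 1 := by
  unfold Kobayashi2003.signedSelmerInfty strictSignedSelmerInfty
  congr 1
  ext n : 1
  rw [signedSelmerLayer_one_eq_strictSignedSelmerLayer_adicCompletion V κ v₀ hv₀ n]

end Summit.BirchSwinnertonDyer.BirchSwinnertonDyer.Theorems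

end
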